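import Summits.ResolutionOfSingularities.ResolutionOfSingularities.Theses.RadicialJung
import Summits.ResolutionOfSingularities.ResolutionOfSingularities.Theorems.PAlterationPalterationThesisIffSummit

/-!
# Crux `CleanModelsSuffice` (stmt-ResolutionOfSingularities-15883) — negative knowledge: what a refutation would be

Route `ResolutionOfSingularities/RadicialJung`, crux `CleanModelsSuffice :=
∀ p, p.Prime → PIAlt_p → CleanModels_p → ResolutionInChar p` (cdisprove seat, cycle 1).

Two kernel-checked facts bounding every disproof attempt on this crux:

* `not_resolutionOfSingularities_of_not_cleanModelsSuffice` — the conclusion of the crux is the summit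
  conjunct, so ANY refutation of the crux is a refutation of resolution of singularities in positive
  characteristic (the crux is sandwiched under the summit; it cannot be killed by a counterexample short
  of a variety over a field with no resolution — none is known, `ledger negatives`: 0);
* `not_cleanModelsSuffice_iff` — through pAlteration's PROVED per-prime frame
  (`Theorems.palterationThesisAt_iff_resolutionInChar : PIAlt_p ∧ PICover_p ↔ ResolutionInChar p`), a
  counterexample to the crux is EXACTLY a prime `p` at which regular purely inseparable alterations
  exist (`PIAlt_p`), log-clean regular models exist (`CleanModels_p`), and yet some finite universally
  injective surjective cover of a regular integral separated finite-type scheme over a field of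
  characteristic `p` has no resolution (`¬ PICover_p`). In particular both antecedents would have to
  STAND at `p`: a refutation of `CleanModels` or of `Pialt` does not touch this crux (it makes the
  `p`-instance vacuous).

The full load-bearing analysis (hypothesis drops, vacuity of the `p = 0` slot, unit absorption in the
toroidal clause, the perfect-field / descent split of the open content `CleanResolves`) is the crux
workfile `Cruxes/CleanModelsSuffice/Disproof.lean`.
-/

set_option linter.dupNamespace false -- mandated namespace of this single-conjunct summit

open CategoryTheory AlgebraicGeometry
open Literature.AlgebraicGeometry.Resolution Literature.AlgebraicGeometry.Motives
open Summit.ResolutionOfSingularities.ResolutionOfSingularities.Theses.RadicialJung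

namespace Summit.ResolutionOfSingularities.ResolutionOfSingularities.Theorems.CleanModelsSuffice.Negative

/-- **A refutation of `CleanModelsSuffice` refutes the summit.** The crux concludes
`ResolutionInChar p`, which `ResolutionOfSingularities` asserts for every prime `p`; contrapose.
[folklore] -/
theorem not_resolutionOfSingularities_of_not_cleanModelsSuffice (h : ¬ CleanModelsSuffice) :
    ¬ _root_.ResolutionOfSingularities :=
  fun hs => h fun p hp _ _ => _root_.ResolutionOfSingularities_iff.mp hs p hp

/-- **The exact shape of a counterexample to `CleanModelsSuffice`**: a prime `p` with `PIAlt_p` and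
`CleanModels_p` standing and `PICover_p` failing — by the proved per-prime frame
`palterationThesisAt_iff_resolutionInChar` (`PIAlt_p ∧ PICover_p ↔ ResolutionInChar p`). [folklore] -/
theorem not_cleanModelsSuffice_iff :
    ¬ CleanModelsSuffice ↔
      ∃ p : ℕ, p.Prime ∧
        (∀ (k : Type) [Field k] [CharP k p] (X : Scheme.{0}) (f : X ⟶ Spec (.of k)),
          IsSeparated f → LocallyOfFiniteType f → QuasiCompact f → IsIntegral X →
          ∃ (X' : Scheme.{0}) (g : X' ⟶ X), IsProper g ∧ IsIntegral X' ∧ Scheme.IsRegular X' ∧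
            Function.Surjective g.base ∧ ∃ U : X.Opens, Dense (U : Set X) ∧ IsFinite (g ∣_ U) ∧
            UniversallyInjective (g ∣_ U)) ∧
        (∀ (k : Type) [Field k] [CharP k p] (W : Scheme.{0}) [IsIntegral W] (f : W ⟶ Spec (.of k))
          (L : Type) [Field L] [Algebra W.functionField L],
          IsSeparated f → LocallyOfFiniteType f → QuasiCompact f → Scheme.IsRegular W →
          IsPurelyInseparable W.functionField L → Module.finrank W.functionField L = p →
          ∃ (V : Scheme.{0}) (π : V ⟶ W) (_ : IsIntegral V) (_ : IsDominant π),
            IsProper π ∧ IsBirational π ∧ Scheme.IsRegular V ∧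
            (∀ v : V, (∃ (y : L) (g : W.functionField),
              y ∉ Set.range (algebraMap W.functionField L) ∧ algebraMap W.functionField L g = y ^ p ∧
              ((∃ (d m : ℕ) (hmd : m ≤ d) (t : Fin d → V.presheaf.stalk v) (a : Fin m → ℕ),
                  Ideal.span (Set.range t) = IsLocalRing.maximalIdeal (V.presheaf.stalk v) ∧
                  ringKrullDim (V.presheaf.stalk v) = (d : WithBot ℕ∞) ∧ 0 < m ∧ (∀ i, ¬ p ∣ a i) ∧
                  RatFn.functionFieldMap π g = ∏ i : Fin m,
                    (algebraMap (V.presheaf.stalk v) V.functionField (t (Fin.castLE hmd i))) ^ (a i)) ∨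
               (∃ u₀ : V.presheaf.stalk v, IsUnit u₀ ∧
                  RatFn.functionFieldMap π g = algebraMap (V.presheaf.stalk v) V.functionField u₀ ∧
                  ((∀ c : V.presheaf.stalk v,
                      u₀ - c ^ p ∉ IsLocalRing.maximalIdeal (V.presheaf.stalk v)) ∨
                   (∃ c : V.presheaf.stalk v,
                      u₀ - c ^ p ∈ IsLocalRing.maximalIdeal (V.presheaf.stalk v) ∧
                      u₀ - c ^ p ∉ IsLocalRing.maximalIdeal (V.presheaf.stalk v) ^ 2))))))) ∧
        ¬ (∀ (k : Type) [Field k] [CharP k p] (Y X : Scheme.{0}) (f : Y ⟶ Spec (.of k)) (g : X ⟶ Y),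
            IsSeparated f → LocallyOfFiniteType f → QuasiCompact f → IsIntegral Y →
            Scheme.IsRegular Y → IsIntegral X → IsFinite g → UniversallyInjective g →
            Function.Surjective g.base → Scheme.HasResolution X) := by
  have key : CleanModelsSuffice ↔ ∀ p : ℕ, p.Prime →
      (∀ (k : Type) [Field k] [CharP k p] (X : Scheme.{0}) (f : X ⟶ Spec (.of k)),
          IsSeparated f → LocallyOfFiniteType f → QuasiCompact f → IsIntegral X →
          ∃ (X' : Scheme.{0}) (g : X' ⟶ X), IsProper g ∧ IsIntegral X' ∧ Scheme.IsRegular X' ∧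
            Function.Surjective g.base ∧ ∃ U : X.Opens, Dense (U : Set X) ∧ IsFinite (g ∣_ U) ∧
            UniversallyInjective (g ∣_ U)) →
        (∀ (k : Type) [Field k] [CharP k p] (W : Scheme.{0}) [IsIntegral W] (f : W ⟶ Spec (.of k))
          (L : Type) [Field L] [Algebra W.functionField L],
          IsSeparated f → LocallyOfFiniteType f → QuasiCompact f → Scheme.IsRegular W →
          IsPurelyInseparable W.functionField L → Module.finrank W.functionField L = p →
          ∃ (V : Scheme.{0}) (π : V ⟶ W) (_ : IsIntegral V) (_ : IsDominant π),
            IsProper π ∧ IsBirational π ∧ Scheme.IsRegular V ∧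
            (∀ v : V, (∃ (y : L) (g : W.functionField),
              y ∉ Set.range (algebraMap W.functionField L) ∧ algebraMap W.functionField L g = y ^ p ∧
              ((∃ (d m : ℕ) (hmd : m ≤ d) (t : Fin d → V.presheaf.stalk v) (a : Fin m → ℕ),
                  Ideal.span (Set.range t) = IsLocalRing.maximalIdeal (V.presheaf.stalk v) ∧
                  ringKrullDim (V.presheaf.stalk v) = (d : WithBot ℕ∞) ∧ 0 < m ∧ (∀ i, ¬ p ∣ a i) ∧
                  RatFn.functionFieldMap π g = ∏ i : Fin m,
                    (algebraMap (V.presheaf.stalk v) V.functionField (t (Fin.castLE hmd i))) ^ (a i)) ∨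
               (∃ u₀ : V.presheaf.stalk v, IsUnit u₀ ∧
                  RatFn.functionFieldMap π g = algebraMap (V.presheaf.stalk v) V.functionField u₀ ∧
                  ((∀ c : V.presheaf.stalk v,
                      u₀ - c ^ p ∉ IsLocalRing.maximalIdeal (V.presheaf.stalk v)) ∨
                   (∃ c : V.presheaf.stalk v,
                      u₀ - c ^ p ∈ IsLocalRing.maximalIdeal (V.presheaf.stalk v) ∧
                      u₀ - c ^ p ∉ IsLocalRing.maximalIdeal (V.presheaf.stalk v) ^ 2))))))) →
        (∀ (k : Type) [Field k] [CharP k p] (Y X : Scheme.{0}) (f : Y ⟶ Spec (.of k)) (g : X ⟶ Y),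
            IsSeparated f → LocallyOfFiniteType f → QuasiCompact f → IsIntegral Y →
            Scheme.IsRegular Y → IsIntegral X → IsFinite g → UniversallyInjective g →
            Function.Surjective g.base → Scheme.HasResolution X) := by
    refine forall₂_congr fun p hp => ?_
    constructor
    · intro h hPI hCM
      exact ((palterationThesisAt_iff_resolutionInChar p hp).mpr (h hPI hCM)).2
    · intro h hPI hCM
      exact (palterationThesisAt_iff_resolutionInChar p hp).mp ⟨hPI, h hPI hCM⟩
  rw [key]
  push Not
  rfl

end Summit.ResolutionOfSingularities.ResolutionOfSingularities.Theorems.CleanModelsSuffice.Negative
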